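import Summits.QuantumFields.YangMills.Theorems.UnitScaleTiltProp7InterpErrorPinReaction
import HarnessLib

/-!
# Route `UnitScaleTilt`, crux K1 «MinimiserStabilityRegPr» (stmt-QuantumFields-19200), route-R E′ path (α′), (E1-b), row (hK₂-W) — FILE 2b′:
# THE NEAR ROW — `tdist(x,y₀)·|Δ(φ − φ_H)(x)| ≤ C_p·ℓ·sup|Δφ|` for `tdist(x, y₀) ≤ n₁ = 13(ℓ∕1024) + 18` around every centre `y₀` (`d = 3`, `ℓ = L^k ≥ 1024`)

Cell `ym3-torus`, width seat `ym3-torus-px7` (gen 3), LOCATE 19200 evidence `LOCATE-HK2W-HARMONIC-px7g3.md` §2 (PIN); FILE 1 ✓ `…InterpErrorLocalLaplaceEnergy` (p669609),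
FILE 2a ✓ `…InterpErrorHarmonicLetters` (p670170), FILE 2b `…InterpErrorPinReaction` ((V-loc), (Q)).  `--supports stmt-QuantumFields-19200`, count-neutral.
THEOREMS ONLY (0 `def`, 0 `sorry`).  YM₃ on T³ is a ladder rung (R3), not the Clay problem; nothing here claims the stub, the crux, d = 4 or the gap.

THE POINT (px4 g2's PIN CONE, as a theorem).  `V := Δφ_H` is harmonic off the centres; near a centre `y₀` write `V = (q₀∕(2c²))·G̃(EK y₀ − EK ·) + W` with `q₀ = (ΔV)(y₀)`
the pin reaction ((Q) ✓ `abs_pin_reaction_le`: `|q₀| ≤ C_q c²ℓM`).  Then `laplace 1 W` is the CONSTANT `q₀∕(c²|T|)` on `{tdist(·,y₀) ≤ 15n₁ + 21}` (✓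
`laplace_one_torusGreen_EK_sub`; no other centre there), so FILE 2a's sourced mean value (✓ `sq_le_of_laplace_one_eq_const`, scale `n₁`) with (V-loc) and
✓ `sum_ball_sq_torusGreen_EK_le` gives `|W| ≤ C_W·M` on `{tdist(·,y₀) ≤ n₁}`; the cone `(q₀∕(2c²))·G̃` is killed by the weight: `|G̃(EK y₀ − EK x)|·tdist(x,y₀) ≤ C₁`.

WHAT IS PROVED (ns `…Theorems.Prop7InterpErrorNearRow`; `P.d = 3`, `j = 0`, `k ≤ m + K`, `c ≠ 0`, `L^k ≥ 1024`, `φ_H` = pinned interpolant of `φ` on `range (embIter k)` biharmonic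
off it, `|Δφ| ≤ M`, `n₁ := 13(L^k∕1024) + 18`).
* §1 letters: `laplace_one_corrected` (`laplace 1 (V − (q₀∕(2c²))g) = q₀∕(c²T)` from `laplace c V = q₀𝟙_{y₀}`, `laplace 1 g = 2(𝟙_{y₀} − T⁻¹)`),
  `mv_const_le`, `mv_const_mul_le`, `source_const_le` (the three numeric rows of the mean-value constants at `d = 3`).
* §2 ★★ `abs_corrected_le_of_near` (`|Δφ_H(x) − (q₀∕(2c²))·G̃(EK y₀ − EK x)| ≤ C_W·M` for `tdist(x, embIter k y₀) ≤ n₁`),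
  ★★★ `tdist_mul_abs_laplace_interp_error_le_of_near` ((PIN): `tdist(x, embIter k y₀)·|Δ(φ − φ_H)(x)| ≤ C_p·L^k·M` for `tdist(x, embIter k y₀) ≤ n₁`).
All constants absolute.  HONEST SCOPE.  Flat letters; the far row and the assembly are FILE 2c.

References: T. Bałaban, CMP 96 (1984) 223–250 [Balaban1984PropagatorsII] ((1.9) p.226); CMP 99 (1985) 75–102 [Balaban1985RegularSpaces] ((1.36) p.82);
CMP 102 (1985) 277–309 [Balaban1985Variational] (Prop. 7 p.299); G. F. Lawler, V. Limic, *Random Walk: A Modern Introduction* (2010), Thm 4.3.1 [LawlerLimic2010].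
-/

set_option autoImplicit false

noncomputable section

open scoped BigOperators

namespace Summit.QuantumFields.YangMills.Theorems.Prop7InterpErrorNearRow

open Literature.MathematicalPhysics.QuantumFieldTheory.Balaban1983to89
open Finset
open LatticeFieldCalculus (laplace)
open B15DeterminingSets (embIter)
open B3Taylor310LocalRemainder (tdist_comm tdist_self)
open B5Eq117TorusCarriers (EK)
open Literature.Probability.LatticeModels (torusGreen TorusSite)
open Summit.QuantumFields.YangMills.Theorems.Prop7CentreHarmonicInterpKernel (laplace_sub')
open Summit.QuantumFields.YangMills.Theorems.Prop7GreenKernelSiteTransport (laplace_one_const_mul)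
open Summit.QuantumFields.YangMills.Theorems.Prop7GreenKernelSiteFreeLaplace (laplace_one_torusGreen_EK_sub)
open Summit.QuantumFields.YangMills.Theorems.Prop7PinnedKernelGeometry (pow_le_tdist_embIter_of_ne)
open Summit.QuantumFields.YangMills.Theorems.Prop7InterpErrorHarmonicLetters (laplace_eq_sq_mul_laplace_one sq_le_of_laplace_one_eq_const
  sum_ball_sq_torusGreen_EK_le abs_torusGreen_EK_sub_mul_tdist_le)
open Summit.QuantumFields.YangMills.Theorems.Prop7InterpErrorPinReaction (scales sum_ball_sq_laplace_interp_le abs_pin_reaction_le)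

variable {P : Params}

/-! ## §1 Letters: the corrected function's Laplacian and the constants at `d = 3` -/

/-- the corrected function `W = V − (q₀∕(2c²))·g` has `laplace 1 W = q₀∕(c²T)` wherever `laplace c V = q₀·𝟙_y` and `laplace 1 g = 2(𝟙_y − T⁻¹)`.
[cite: Balaban1985Variational, Prop. 7 p.299] -/
theorem laplace_one_corrected {c T q₀ : ℝ} (hc : c ≠ 0) (hT : T ≠ 0) (V g : SiteField P 0 ℝ) (y z : Site P 0)
    (hV : laplace c V z = if z = y then q₀ else 0) (hg : laplace 1 g z = 2 * ((if z = y then (1 : ℝ) else 0) - T⁻¹)) :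
    laplace 1 (fun w => V w - q₀ / (2 * c ^ 2) * g w) z = q₀ / (c ^ 2 * T) := by
  classical
  have e1 : laplace 1 (fun w => V w - q₀ / (2 * c ^ 2) * g w) z = laplace 1 V z - q₀ / (2 * c ^ 2) * laplace 1 g z := by
    rw [laplace_sub']
    dsimp only
    rw [laplace_one_const_mul]
  have e2 : laplace 1 V z = laplace c V z / c ^ 2 := by
    rw [laplace_eq_sq_mul_laplace_one c V z]; field_simp
  rw [e1, e2, hV, hg]
  split_ifs <;> field_simp <;> ring

/-- the mean-value constant at scale `n₁` against `ℓ ≤ 158n₁` (`d = 3`). [folklore] -/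
theorem mv_const_le (d : ℕ) (hd : d = 3) {n ℓ : ℝ} (hn : 0 < n) (hℓ : 0 < ℓ) (h : ℓ ≤ 158 * n) :
    (2 : ℝ) ^ d * (1 + 56 * (d : ℝ)) ^ d / (n + 1) ^ d ≤ 8 * 169 ^ 3 * 158 ^ 3 / ℓ ^ 3 := by
  subst hd
  push_cast
  rw [div_le_div_iff₀ (by positivity) (by positivity)]
  have h1 : ℓ ^ 3 ≤ (158 * (n + 1)) ^ 3 := pow_le_pow_left₀ hℓ.le (by linarith) 3
  nlinarith

/-- the mean-value constant times the box count `(2r+1)³`, `r = 5n₁ + 6` (`d = 3`). [folklore] -/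
theorem mv_const_mul_le (d : ℕ) (hd : d = 3) {n : ℝ} (hn : 2 ≤ n) {r : ℕ} (hr : (r : ℝ) = 5 * n + 6) :
    (2 : ℝ) ^ d * (1 + 56 * (d : ℝ)) ^ d / (n + 1) ^ d * (2 * (r : ℝ) + 1) ^ d ≤ 8 * 169 ^ 3 * 1331 := by
  subst hd
  push_cast
  have hn0 : 0 < n := by linarith
  rw [hr, div_mul_eq_mul_div, div_le_iff₀ (by positivity)]
  have h1 : (2 * (5 * n + 6) + 1) ^ 3 ≤ (11 * (n + 1)) ^ 3 := pow_le_pow_left₀ (by positivity) (by linarith) 3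
  nlinarith [pow_pos (by linarith : (0:ℝ) < n + 1) 3]

/-- the source size of the sourced mean-value bound, `r = 5n₁ + 6`, `|σ| ≤ C∕ℓ²`, `18 ≤ n₁ ≤ ℓ` (`d = 3`). [folklore] -/
theorem source_const_le (d : ℕ) (hd : d = 3) {σ n ℓ C : ℝ} {r : ℕ} (hr : (r : ℝ) = 5 * n + 6) (h18 : 18 ≤ n) (hnℓ : n ≤ ℓ)
    (hC : 0 ≤ C) (hσ : |σ| ≤ C / ℓ ^ 2) :
    64 * (2 : ℝ) ^ d * (d : ℝ) * (|σ| * ((r : ℝ) + 1) / (d : ℝ)) * (2 * (r : ℝ) + 1) ≤ 33792 * C := by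
  subst hd
  push_cast
  rw [hr]
  have hℓ : 0 < ℓ := by linarith
  have e1 : 64 * (2 : ℝ) ^ 3 * 3 * (|σ| * (5 * n + 6 + 1) / 3) * (2 * (5 * n + 6) + 1) = 512 * |σ| * ((5 * n + 7) * (10 * n + 13)) := by ring
  rw [e1]
  have h66 : (5 * n + 7) * (10 * n + 13) ≤ 66 * n ^ 2 := by nlinarith
  have hσn : |σ| * n ^ 2 ≤ C := by
    calc |σ| * n ^ 2 ≤ C / ℓ ^ 2 * ℓ ^ 2 := mul_le_mul hσ (pow_le_pow_left₀ (by linarith) hnℓ 2) (by positivity) (by positivity)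
      _ = C := by field_simp
  nlinarith [abs_nonneg σ, mul_le_mul_of_nonneg_left h66 (by positivity : (0:ℝ) ≤ 512 * |σ|)]

/-! ## §2 The near row -/

/-- ★★ **THE CORRECTED FUNCTION IS BOUNDED NEAR THE PIN**: there is an absolute `C_W > 0` such that, for `L^k ≥ 1024`, every centre `y₀` and every
`x` with `tdist(x, embIter k y₀) ≤ n₁`:  `|Δφ_H(x) − (q₀∕(2c²))·G̃(EK y₀ − EK x)| ≤ C_W·M`, `q₀ = Δ(Δφ_H)(embIter k y₀)`
(`laplace 1` of the corrected function is the CONSTANT `q₀∕(c²|T|)` on `{tdist(·,y₀) ≤ 15n₁ + 21}` — ✓ `laplace_one_torusGreen_EK_sub`, no other centre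
there —; FILE 2a ✓ `sq_le_of_laplace_one_eq_const` at scale `n₁`, (V-loc), ✓ `sum_ball_sq_torusGreen_EK_le`, (Q)).
[cite: Balaban1985Variational, Prop. 7 p.299; Balaban1984PropagatorsII, (1.9) p.226] -/
theorem abs_corrected_le_of_near : ∃ CW : ℝ, 0 < CW ∧
    ∀ (P : Params) (_ : P.d = 3) (k : ℕ) (hk : k ≤ P.m + P.K) (c : ℝ) (_ : c ≠ 0) (_ : 1024 ≤ P.L ^ k)
      (φ φH : SiteField P 0 ℝ) (_ : ∀ x ∈ Set.range (embIter k), φH x = φ x)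
      (_ : ∀ x ∉ Set.range (embIter k), laplace c (laplace c φH) x = 0) (M : ℝ) (_ : ∀ z, |laplace c φ z| ≤ M)
      (y₀ : Site P k) (x : Site P 0) (_ : Site.tdist x (embIter k y₀) ≤ 13 * (P.L ^ k / 1024) + 18),
      |laplace c φH x - laplace c (laplace c φH) (embIter k y₀) / (2 * c ^ 2) *
          torusGreen (L := P.L ^ k * P.sitesPerDir k) (EK hk (embIter k y₀) - EK hk x)| ≤ CW * M := by
  obtain ⟨CV, hCV, hV⟩ := sum_ball_sq_laplace_interp_le
  obtain ⟨Cq, hCq, hQ⟩ := abs_pin_reaction_le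
  obtain ⟨CG, hCG, hGsum⟩ := sum_ball_sq_torusGreen_EK_le
  set K0 : ℝ := 8 * 169 ^ 3 with hK0
  set CW2 : ℝ := 4 * (K0 * 158 ^ 3) * (2 * CV + Cq ^ 2 * CG) + (4 * (K0 * 1331) + 2) * (33792 * Cq) ^ 2 with hCW2
  have hCW2pos : 0 < CW2 := by rw [hCW2, hK0]; positivity
  refine ⟨Real.sqrt CW2, Real.sqrt_pos.2 hCW2pos, ?_⟩
  intro P hd k hk c hc hℓk φ φH hH hEL M hφ y₀ x hx
  classical
  obtain ⟨hq1, hq2, hq3, h9, h15, h158, hn1ℓ, h11, h12, h8⟩ := scales hℓk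
  set q : ℕ := P.L ^ k / 1024 with hq
  set n₁ : ℕ := 13 * q + 18 with hn₁
  set ℓ : ℝ := (P.L : ℝ) ^ k with hℓdef
  have hℓN : ((P.L ^ k : ℕ) : ℝ) = ℓ := by push_cast; rfl
  have hL1 : (1 : ℝ) ≤ (P.L : ℝ) := by exact_mod_cast P.L_pos
  have hℓ1 : 1 ≤ ℓ := one_le_pow₀ hL1
  have hℓ0 : 0 < ℓ := by linarith
  have hM : 0 ≤ M := (abs_nonneg _).trans (hφ x)
  have hd3 : (P.d : ℝ) = 3 := by exact_mod_cast hd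
  have hd1 : 1 ≤ P.d := P.hd
  have hc2 : 0 < c ^ 2 := by positivity
  set y₀' : Site P 0 := embIter k y₀ with hy₀'
  set V : SiteField P 0 ℝ := laplace c φH with hVdef
  have hn₁ℓ : (n₁ : ℝ) ≤ ℓ := by rw [← hℓN]; exact_mod_cast hn1ℓ
  have h158ℓ : ℓ ≤ 158 * (n₁ : ℝ) := by rw [← hℓN]; exact_mod_cast h158
  have hn₁0 : (0 : ℝ) < n₁ := by rw [hn₁]; push_cast; linarith [(Nat.cast_nonneg q : (0:ℝ) ≤ q)]
  have h18R : (18 : ℝ) ≤ n₁ := by exact_mod_cast (by omega : 18 ≤ n₁)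
  -- the pin reaction, the period, the Green function, the corrected function
  set q₀ : ℝ := laplace c V y₀' with hq₀
  have hq₀le : |q₀| ≤ Cq * c ^ 2 * ℓ * M := hQ P hd k hk c hc hℓk φ φH hH hEL M hφ y₀
  set T : ℝ := (((P.L ^ k * P.sitesPerDir k : ℕ) : ℝ)) ^ P.d with hT
  have hT1 : ℓ ^ 3 ≤ T := by
    rw [hT, hd, ← hℓN]
    exact_mod_cast Nat.pow_le_pow_left (Nat.le_mul_of_pos_right _ (Nat.pos_of_ne_zero (P.sitesPerDir_ne_zero k))) 3
  have hT0 : 0 < T := lt_of_lt_of_le (by positivity) hT1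
  set g : SiteField P 0 ℝ := fun z => torusGreen (L := P.L ^ k * P.sitesPerDir k) (EK hk y₀' - EK hk z) with hgdef
  set a : ℝ := q₀ / (2 * c ^ 2) with ha
  set W : SiteField P 0 ℝ := fun z => V z - a * g z with hWdef
  set σ : ℝ := q₀ / (c ^ 2 * T) with hσ
  -- `laplace c V = q₀·𝟙_{y₀'}` on the ball `{tdist(·,y₀') ≤ 15n₁ + 21}` (no other centre there)
  have hVlap : ∀ z, (Site.tdist z y₀' : ℝ) ≤ 15 * n₁ + 21 → laplace c V z = if z = y₀' then q₀ else 0 := by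
    intro z hz
    split_ifs with hzy
    · rw [hzy]
    · have hzC : z ∉ Set.range (embIter k) := by
        rintro ⟨y, rfl⟩
        have hne : y ≠ y₀ := fun h => hzy (by rw [h])
        have ht : (P.L ^ k : ℝ) ≤ Site.tdist (embIter k y) y₀' := by
          rw [hy₀']; exact_mod_cast pow_le_tdist_embIter_of_ne hk hne
        have h15' : 15 * (n₁ : ℝ) + 21 < ℓ := by rw [← hℓN]; exact_mod_cast h15
        linarith
      rw [hVdef]; exact hEL z hzC
  -- `laplace 1 W ≡ σ` there
  have hWlap : ∀ z, (Site.tdist z y₀' : ℝ) ≤ 15 * n₁ + 21 → laplace 1 W z = σ := by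
    intro z hz
    have e3 : laplace 1 g z = 2 * ((if z = y₀' then (1 : ℝ) else 0) - T⁻¹) := by
      rw [hgdef, hT]; exact laplace_one_torusGreen_EK_sub hk y₀' z
    rw [hWdef, ha, hσ]
    exact laplace_one_corrected hc hT0.ne' V g y₀' z (hVlap z hz) e3
  -- FILE 2a's sourced mean value at scale `n₁`, `ρ₀ = n₁`, `r = 5n₁ + 6`
  set r : ℕ := 5 * n₁ + 6 with hr5
  have hr : r = n₁ + n₁ + P.d * (n₁ + 2) := by rw [hr5, hd]; ring
  have hr5R : ((r : ℕ) : ℝ) = 5 * (n₁ : ℝ) + 6 := by rw [hr5]; push_cast; ring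
  have hN : 2 * (r + 1) < P.sitesPerDir 0 := by
    have h2N : 2 * P.L ^ k ≤ P.sitesPerDir 0 := by
      show 2 * P.L ^ k ≤ 2 * P.L ^ (P.m + P.K - 0)
      exact Nat.mul_le_mul_left 2 (Nat.pow_le_pow_right P.L_pos (by omega))
    rw [hr5]; omega
  have hreg : (P.d : ℝ) * ((r : ℝ) + 1) ≤ 15 * n₁ + 21 := by rw [hd3, hr5R]; linarith
  have h3r : (P.d : ℝ) * r = ((15 * n₁ + 18 : ℕ) : ℝ) := by rw [hd3, hr5R]; push_cast; ring
  have hMV := sq_le_of_laplace_one_eq_const hd1 y₀' W σ (le_trans (by norm_num) (by omega : 18 ≤ n₁)) hr hN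
    (le_of_eq h3r) (fun z hz => hWlap z (hz.trans hreg)) x (by rw [hy₀']; exact hx)
  -- the mass of `W` on the ball of radius `3r = 15n₁ + 18`
  have hρℓ : ((15 * n₁ + 18 : ℕ) : ℝ) ≤ ℓ := by rw [← hℓN]; exact_mod_cast (by omega : 15 * n₁ + 18 ≤ P.L ^ k)
  have hVsum := hV P hd k hk c hc y₀' ((15 * n₁ + 18 : ℕ) : ℝ) (by positivity) hρℓ φ φH hH hEL M hφ
  have hGs := hGsum P hd k hk y₀' (15 * n₁ + 18)
  have ha2 : a ^ 2 ≤ Cq ^ 2 * ℓ ^ 2 * M ^ 2 / 4 := by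
    have h1 : |a| ≤ Cq * ℓ * M / 2 := by
      rw [ha, abs_div, abs_of_pos (by positivity : (0:ℝ) < 2 * c ^ 2), div_le_div_iff₀ (by positivity) (by norm_num)]
      calc |q₀| * 2 ≤ Cq * c ^ 2 * ℓ * M * 2 := mul_le_mul_of_nonneg_right hq₀le (by norm_num)
        _ = Cq * ℓ * M * (2 * c ^ 2) := by ring
    have h2 : a ^ 2 ≤ (Cq * ℓ * M / 2) ^ 2 := by rw [← sq_abs]; exact pow_le_pow_left₀ (abs_nonneg _) h1 2
    calc a ^ 2 ≤ (Cq * ℓ * M / 2) ^ 2 := h2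
      _ = Cq ^ 2 * ℓ ^ 2 * M ^ 2 / 4 := by ring
  have hWsum : ∑ z ∈ Finset.univ.filter (fun z : Site P 0 => (Site.tdist z y₀' : ℝ) ≤ ((15 * n₁ + 18 : ℕ) : ℝ)), W z ^ 2
      ≤ (2 * CV + Cq ^ 2 * CG) * ℓ ^ 3 * M ^ 2 := by
    have hpt : ∀ z, W z ^ 2 ≤ 2 * V z ^ 2 + 2 * a ^ 2 * g z ^ 2 := fun z => by
      have h : (V z - a * g z) ^ 2 ≤ 2 * V z ^ 2 + 2 * (a * g z) ^ 2 := by linarith only [sq_nonneg (V z + a * g z)]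
      rw [mul_pow, ← mul_assoc] at h
      exact h
    refine (Finset.sum_le_sum fun z _ => hpt z).trans ?_
    rw [Finset.sum_add_distrib, ← Finset.mul_sum, ← Finset.mul_sum]
    have hρ1 : ((15 * n₁ + 18 : ℕ) : ℝ) + 1 ≤ 2 * ℓ := by linarith
    calc 2 * ∑ z ∈ _, V z ^ 2 + 2 * a ^ 2 * ∑ z ∈ _, g z ^ 2
        ≤ 2 * (CV * ℓ ^ 3 * M ^ 2) + 2 * (Cq ^ 2 * ℓ ^ 2 * M ^ 2 / 4) * (CG * (2 * ℓ)) := by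
          refine add_le_add (mul_le_mul_of_nonneg_left hVsum (by norm_num)) ?_
          refine mul_le_mul (mul_le_mul_of_nonneg_left ha2 (by norm_num)) (hGs.trans (mul_le_mul_of_nonneg_left hρ1 hCG))
            (Finset.sum_nonneg fun _ _ => sq_nonneg _) (by positivity)
      _ = (2 * CV + Cq ^ 2 * CG) * ℓ ^ 3 * M ^ 2 := by ring
  -- the constants of the mean-value bound
  have hK : (2 : ℝ) ^ P.d * (1 + 56 * (P.d : ℝ)) ^ P.d / ((n₁ : ℝ) + 1) ^ P.d ≤ K0 * 158 ^ 3 / ℓ ^ 3 := by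
    rw [hK0]; exact mv_const_le P.d hd hn₁0 hℓ0 h158ℓ
  have hK' : (2 : ℝ) ^ P.d * (1 + 56 * (P.d : ℝ)) ^ P.d / ((n₁ : ℝ) + 1) ^ P.d * (2 * (r : ℝ) + 1) ^ P.d ≤ K0 * 1331 := by
    rw [hK0]; exact mv_const_mul_le P.d hd (by linarith) hr5R
  have hσle : |σ| ≤ Cq * M / ℓ ^ 2 := by
    rw [hσ, abs_div, abs_of_pos (mul_pos hc2 hT0), div_le_div_iff₀ (mul_pos hc2 hT0) (by positivity)]
    calc |q₀| * ℓ ^ 2 ≤ Cq * c ^ 2 * ℓ * M * ℓ ^ 2 := mul_le_mul_of_nonneg_right hq₀le (by positivity)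
      _ = Cq * M * (c ^ 2 * ℓ ^ 3) := by ring
      _ ≤ Cq * M * (c ^ 2 * T) := mul_le_mul_of_nonneg_left (mul_le_mul_of_nonneg_left hT1 hc2.le) (by positivity)
  have hm : 64 * (2 : ℝ) ^ P.d * (P.d : ℝ) * (|σ| * ((r : ℝ) + 1) / (P.d : ℝ)) * (2 * (r : ℝ) + 1) ≤ 33792 * (Cq * M) :=
    source_const_le P.d hd hr5R h18R hn₁ℓ (by positivity) hσle
  -- `W(x)² ≤ CW2·M²`
  have t1 : 4 * ((2 : ℝ) ^ P.d * (1 + 56 * (P.d : ℝ)) ^ P.d / ((n₁ : ℝ) + 1) ^ P.d) *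
      ∑ z ∈ Finset.univ.filter (fun z : Site P 0 => (Site.tdist z y₀' : ℝ) ≤ ((15 * n₁ + 18 : ℕ) : ℝ)), W z ^ 2
        ≤ 4 * (K0 * 158 ^ 3) * (2 * CV + Cq ^ 2 * CG) * M ^ 2 := by
    calc 4 * ((2 : ℝ) ^ P.d * (1 + 56 * (P.d : ℝ)) ^ P.d / ((n₁ : ℝ) + 1) ^ P.d) *
        ∑ z ∈ Finset.univ.filter (fun z : Site P 0 => (Site.tdist z y₀' : ℝ) ≤ ((15 * n₁ + 18 : ℕ) : ℝ)), W z ^ 2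
        ≤ 4 * (K0 * 158 ^ 3 / ℓ ^ 3) * ((2 * CV + Cq ^ 2 * CG) * ℓ ^ 3 * M ^ 2) :=
          mul_le_mul (mul_le_mul_of_nonneg_left hK (by norm_num)) hWsum (Finset.sum_nonneg fun _ _ => sq_nonneg _) (by positivity)
      _ = 4 * (K0 * 158 ^ 3) * (2 * CV + Cq ^ 2 * CG) * M ^ 2 * (ℓ ^ 3 / ℓ ^ 3) := by ring
      _ = 4 * (K0 * 158 ^ 3) * (2 * CV + Cq ^ 2 * CG) * M ^ 2 := by rw [div_self (by positivity), mul_one]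
  have t2 : (4 * ((2 : ℝ) ^ P.d * (1 + 56 * (P.d : ℝ)) ^ P.d / ((n₁ : ℝ) + 1) ^ P.d) * (2 * (r : ℝ) + 1) ^ P.d + 2) *
      (64 * (2 : ℝ) ^ P.d * (P.d : ℝ) * (|σ| * ((r : ℝ) + 1) / (P.d : ℝ)) * (2 * (r : ℝ) + 1)) ^ 2
        ≤ (4 * (K0 * 1331) + 2) * (33792 * (Cq * M)) ^ 2 := by
    refine mul_le_mul (by rw [mul_assoc]; linarith) (pow_le_pow_left₀ (by positivity) hm 2) (sq_nonneg _) (by positivity)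
  have hWx : W x ^ 2 ≤ CW2 * M ^ 2 := by
    refine (hMV.trans (add_le_add t1 t2)).trans (le_of_eq ?_)
    rw [hCW2]; ring
  have hWabs : |W x| ≤ Real.sqrt CW2 * M := by
    rw [← Real.sqrt_sq (abs_nonneg (W x)), sq_abs, ← Real.sqrt_sq hM, ← Real.sqrt_mul hCW2pos.le]
    exact Real.sqrt_le_sqrt hWx
  simpa only [hWdef, hVdef, ha, hq₀, hgdef, hy₀'] using hWabs

/-- ★★★ **(PIN) THE NEAR ROW OF (hK₂-W)**: there is an absolute `C_p > 0` such that, for `L^k ≥ 1024`, every centre `y₀` and every `x` with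
`tdist(x, embIter k y₀) ≤ n₁ = 13(L^k∕1024) + 18`:  `tdist(x, embIter k y₀)·|Δ(φ − φ_H)(x)| ≤ C_p·L^k·M`
(`Δ(φ − φ_H) = Δφ − V`, `V = (q₀∕(2c²))·G̃(EK y₀ − EK ·) + W`; `|W| ≤ C_W·M` by `abs_corrected_le_of_near`, `|G̃(EK y₀ − EK x)|·tdist ≤ C₁` kills the cone,
`|q₀| ≤ C_q c²ℓM` by (Q)). [cite: Balaban1985Variational, Prop. 7 p.299; Balaban1985RegularSpaces, (1.36) p.82] -/
theorem tdist_mul_abs_laplace_interp_error_le_of_near : ∃ Cp : ℝ, 0 < Cp ∧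
    ∀ (P : Params) (_ : P.d = 3) (k : ℕ) (hk : k ≤ P.m + P.K) (c : ℝ) (_ : c ≠ 0) (_ : 1024 ≤ P.L ^ k)
      (φ φH : SiteField P 0 ℝ) (_ : ∀ x ∈ Set.range (embIter k), φH x = φ x)
      (_ : ∀ x ∉ Set.range (embIter k), laplace c (laplace c φH) x = 0) (M : ℝ) (_ : ∀ z, |laplace c φ z| ≤ M)
      (y₀ : Site P k) (x : Site P 0) (_ : Site.tdist x (embIter k y₀) ≤ 13 * (P.L ^ k / 1024) + 18),
      (Site.tdist x (embIter k y₀) : ℝ) * |laplace c (fun z => φ z - φH z) x| ≤ Cp * (P.L : ℝ) ^ k * M := by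
  obtain ⟨Cq, hCq, hQ⟩ := abs_pin_reaction_le
  obtain ⟨CW, hCW, hWb⟩ := abs_corrected_le_of_near
  obtain ⟨C₁, hC₁, hG1⟩ := abs_torusGreen_EK_sub_mul_tdist_le
  refine ⟨1 + Cq * C₁ / 2 + CW, by positivity, ?_⟩
  intro P hd k hk c hc hℓk φ φH hH hEL M hφ y₀ x hx
  classical
  obtain ⟨hq1, hq2, hq3, h9, h15, h158, hn1ℓ, h11, h12, h8⟩ := scales hℓk
  set n₁ : ℕ := 13 * (P.L ^ k / 1024) + 18 with hn₁
  set ℓ : ℝ := (P.L : ℝ) ^ k with hℓdef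
  have hℓN : ((P.L ^ k : ℕ) : ℝ) = ℓ := by push_cast; rfl
  have hM : 0 ≤ M := (abs_nonneg _).trans (hφ x)
  have hc2 : 0 < c ^ 2 := by positivity
  set y₀' : Site P 0 := embIter k y₀ with hy₀'
  have hn₁ℓ : (n₁ : ℝ) ≤ ℓ := by rw [← hℓN]; exact_mod_cast hn1ℓ
  have hn₁0 : (0 : ℝ) ≤ n₁ := Nat.cast_nonneg _
  have htx : (Site.tdist x y₀' : ℝ) ≤ n₁ := by rw [hy₀']; exact_mod_cast hx
  have ht0 : (0 : ℝ) ≤ Site.tdist x y₀' := Nat.cast_nonneg _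
  -- the case `x = y₀'`: the weight vanishes
  rcases eq_or_ne x y₀' with hxy | hxy
  · rw [hxy, hy₀', tdist_self]; simp only [Nat.cast_zero, zero_mul]; positivity
  -- letters
  set q₀ : ℝ := laplace c (laplace c φH) y₀' with hq₀
  set g : ℝ := torusGreen (L := P.L ^ k * P.sitesPerDir k) (EK hk y₀' - EK hk x) with hg
  set a : ℝ := q₀ / (2 * c ^ 2) with ha
  have hq₀le : |q₀| ≤ Cq * c ^ 2 * ℓ * M := hQ P hd k hk c hc hℓk φ φH hH hEL M hφ y₀
  have hW : |laplace c φH x - a * g| ≤ CW * M := by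
    have := hWb P hd k hk c hc hℓk φ φH hH hEL M hφ y₀ x hx
    rw [ha, hq₀, hg, hy₀']; exact this
  have hcone : |g| * (Site.tdist x y₀' : ℝ) ≤ C₁ := by
    have := hG1 P hd k hk y₀' x hxy
    rw [tdist_comm] at this
    rw [hg]; exact this
  have haabs : |a| ≤ Cq * ℓ * M / 2 := by
    rw [ha, abs_div, abs_of_pos (by positivity : (0:ℝ) < 2 * c ^ 2), div_le_div_iff₀ (by positivity) (by norm_num)]
    calc |q₀| * 2 ≤ Cq * c ^ 2 * ℓ * M * 2 := mul_le_mul_of_nonneg_right hq₀le (by norm_num)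
      _ = Cq * ℓ * M * (2 * c ^ 2) := by ring
  -- `V x = a·g + (V x − a·g)`
  have hVx : (Site.tdist x y₀' : ℝ) * |laplace c φH x| ≤ (Cq * C₁ / 2 + CW) * ℓ * M := by
    have eV : laplace c φH x = a * g + (laplace c φH x - a * g) := by ring
    rw [eV]
    calc (Site.tdist x y₀' : ℝ) * |a * g + (laplace c φH x - a * g)|
        ≤ (Site.tdist x y₀' : ℝ) * (|a| * |g| + |laplace c φH x - a * g|) :=
          mul_le_mul_of_nonneg_left ((abs_add_le _ _).trans (by rw [abs_mul])) ht0
      _ = |a| * (|g| * (Site.tdist x y₀' : ℝ)) + (Site.tdist x y₀' : ℝ) * |laplace c φH x - a * g| := by ring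
      _ ≤ (Cq * ℓ * M / 2) * C₁ + (n₁ : ℝ) * (CW * M) :=
          add_le_add (mul_le_mul haabs hcone (by positivity) (by positivity)) (mul_le_mul htx hW (abs_nonneg _) hn₁0)
      _ ≤ (Cq * ℓ * M / 2) * C₁ + ℓ * (CW * M) := by
          have := mul_le_mul_of_nonneg_right hn₁ℓ (by positivity : (0:ℝ) ≤ CW * M); linarith
      _ = (Cq * C₁ / 2 + CW) * ℓ * M := by ring
  have hex : laplace c (fun z => φ z - φH z) x = laplace c φ x - laplace c φH x := by rw [laplace_sub']
  rw [hex]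
  calc (Site.tdist x y₀' : ℝ) * |laplace c φ x - laplace c φH x|
      ≤ (Site.tdist x y₀' : ℝ) * (|laplace c φ x| + |laplace c φH x|) := mul_le_mul_of_nonneg_left (abs_sub _ _) ht0
    _ = (Site.tdist x y₀' : ℝ) * |laplace c φ x| + (Site.tdist x y₀' : ℝ) * |laplace c φH x| := by ring
    _ ≤ (n₁ : ℝ) * M + (Cq * C₁ / 2 + CW) * ℓ * M := add_le_add (mul_le_mul htx (hφ x) (abs_nonneg _) hn₁0) hVx
    _ ≤ ℓ * M + (Cq * C₁ / 2 + CW) * ℓ * M := by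
        have := mul_le_mul_of_nonneg_right hn₁ℓ hM; linarith
    _ = (1 + Cq * C₁ / 2 + CW) * ℓ * M := by ring

end Summit.QuantumFields.YangMills.Theorems.Prop7InterpErrorNearRow

end
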